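import Literature.NumberTheory.LFunctions.ZetaCertifiedTablesFast
import HarnessLib

/-!
# Faster `log` tables for the certified evaluators of `ζ(s)`: the `1/p²` series with per-prime lengths

Topic `Literature/NumberTheory/LFunctions`. The table builder `mkTablesFast`
(`ZetaCertifiedTablesFast.lean`) computes `log p` for a prime `p ≤ N` from
`log p = log (p-1) - log (1 - 1/p)`, spending a FIXED number `K` of series terms (ratio `1/p`) on
every prime. At the `~11 000`-bit scale of the Best–Trudgian certificate (`MertensCertificateBT2.lean`)
this is the larger half of the table cost (≈ 40 s of ≈ 85 s per block). This file provides a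
drop-in builder `mkTablesFast2` with the SAME output type `Tables` and the same validity predicate
(so `mem_zetaBox` / `mem_zetaBoxFast` / `mem_zetaBall` apply verbatim) whose `log` table uses, for an
odd prime `p`,

  `2 log p = log (p-1) + log 2 + log ((p+1)/2) - log (1 - 1/p²)`

(all three logarithms on the right are earlier entries), i.e. a series of ratio `1/p²` — half as
many terms — with the number of terms chosen per prime, `⌈bits / (2 log₂ p)⌉ + 2`.

## Main definitions and results (namespace `Literature.NumberTheory.LFunctions.ZetaNumerics`)

* `mkLogsSq`, `mkLogsSq_spec` — size `n + 1` and `log m ∈ logs[m]`, `1 ≤ m ≤ n`;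
* `mkTablesFast2`, **`mkTablesFast2_valid`**, `mkTablesFast2_S`, `mkTablesFast2_N`.

## References

* H. M. Edwards, *Riemann's Zeta Function* (1974), §6.4. [Edwards1974]
* R. P. Brent, P. Zimmermann, *Modern Computer Arithmetic* (2010), §4.4 (argument reduction for `log`). [BrentZimmermann2010]
-/

open Finset
open Literature.Analysis.ValidatedNumerics.NumericsMP

namespace Literature.NumberTheory.LFunctions.ZetaNumerics

/-! ## The `log` table by the `1/p²` series -/

/-- The `log` table `[junk, log 1, …, log n]` at scale `S'`: `log 1 = 0`; `log 2` by `logTwo`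
(`bits + 2` terms); for `m ≥ 3` with `minFac m = m` (an odd prime),
`log m = ½ (log (m-1) + log 2 + log ((m+1)/2) - log (1 - 1/m²))` with `⌈bits/(2 log₂ m)⌉ + 2` terms;
otherwise `log m = log p + log (m/p)`, `p = minFac m` (`none` on failure). [folklore] -/
def mkLogsSq (S' bits : ℕ) : ℕ → Option (Array MI)
  | 0 => some #[default]
  | n + 1 =>
    match mkLogsSq S' bits n with
    | none => none
    | some A =>
      if n = 0 then some (A.push (MI.ofInt S' 0))
      else if n = 1 then
        match MI.logTwo S' (bits + 2) with
        | some L => some (A.push L)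
        | none => none
      else if (n + 1).minFac = n + 1 then
        let K := bits / (2 * Nat.log2 (n + 1)) + 2
        match MI.logOneSub S' K (MI.ofFrac S' 1 ((n + 1) * (n + 1))) with
        | some Y => some (A.push ((((A.getD n default).add (A.getD 2 default)).add
            (A.getD ((n + 2) / 2) default)).sub Y |>.divNat 2))
        | none => none
      else
        some (A.push ((A.getD (n + 1).minFac default).add (A.getD ((n + 1) / (n + 1).minFac) default)))

/-- Reading an old entry after a `push`. [folklore] -/
private lemma getD_push_of_lt' {A : Array MI} {x : MI} {m : ℕ} (hm : m < A.size) :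
    (A.push x).getD m default = A.getD m default := by
  rw [Array.getD_eq_getD_getElem?, Array.getElem?_push_lt hm, Option.getD_some,
    Array.getD_eq_getD_getElem?, getElem?_pos A m hm, Option.getD_some]

/-- Reading the new entry after a `push`. [folklore] -/
private lemma getD_push_size' {A : Array MI} {x : MI} :
    (A.push x).getD A.size default = x := by
  rw [Array.getD_eq_getD_getElem?, Array.getElem?_push_size, Option.getD_some]

/-- The identity behind the odd-prime step:
`log m = ½ (log (m-1) + log 2 + log ((m+1)/2) - log (1 - 1/m²))` for odd `m ≥ 3`. [folklore] -/
lemma log_odd_eq {m : ℕ} (hm : 3 ≤ m) (hodd : m % 2 = 1) :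
    Real.log m = (Real.log (m - 1 : ℕ) + Real.log 2 + Real.log ((m + 1) / 2 : ℕ) -
      Real.log (1 - ((1 : ℤ) : ℝ) / ((m * m : ℕ) : ℕ))) / 2 := by
  have hmr : (3 : ℝ) ≤ m := by exact_mod_cast hm
  have hm0 : (0 : ℝ) < m := by linarith
  have e1 : ((m - 1 : ℕ) : ℝ) = (m : ℝ) - 1 := by rw [Nat.cast_sub (by omega)]; simp
  have e2 : (((m + 1) / 2 : ℕ) : ℝ) = ((m : ℝ) + 1) / 2 := by
    obtain ⟨k, hk⟩ : ∃ k, m = 2 * k + 1 := ⟨m / 2, by omega⟩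
    subst hk
    have : (2 * k + 1 + 1) / 2 = k + 1 := by omega
    rw [this]; push_cast; ring
  have e3 : (1 : ℝ) - ((1 : ℤ) : ℝ) / ((m * m : ℕ) : ℕ) = ((m : ℝ) - 1) * ((m : ℝ) + 1) / ((m : ℝ) * m) := by
    push_cast; field_simp; ring
  rw [e1, e2, e3]
  have hpos1 : (0 : ℝ) < (m : ℝ) - 1 := by linarith
  have hpos2 : (0 : ℝ) < (m : ℝ) + 1 := by linarith
  have l1 : Real.log (((m : ℝ) + 1) / 2) = Real.log ((m : ℝ) + 1) - Real.log 2 :=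
    Real.log_div hpos2.ne' (by norm_num)
  have l2 : Real.log (((m : ℝ) - 1) * ((m : ℝ) + 1) / ((m : ℝ) * m)) =
      Real.log ((m : ℝ) - 1) + Real.log ((m : ℝ) + 1) - (Real.log m + Real.log m) := by
    rw [Real.log_div (by positivity) (by positivity), Real.log_mul hpos1.ne' hpos2.ne',
      Real.log_mul hm0.ne' hm0.ne']
  rw [l1, l2]
  ring

/-- Soundness of `mkLogsSq`: size `n + 1` and `log m ∈ logs[m]` for `1 ≤ m ≤ n`. [folklore] -/
theorem mkLogsSq_spec {S' bits : ℕ} (hS' : 0 < S') :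
    ∀ (n : ℕ) {A : Array MI}, mkLogsSq S' bits n = some A →
      A.size = n + 1 ∧ ∀ m : ℕ, 1 ≤ m → m ≤ n → MI.mem S' (Real.log m) (A.getD m default)
  | 0, A, h => by
    simp only [mkLogsSq, Option.some.injEq] at h
    subst h
    exact ⟨rfl, fun m h1 h2 ↦ by omega⟩
  | n + 1, A, h => by
    simp only [mkLogsSq] at h
    split at h
    · simp at h
    · rename_i A0 hA0
      obtain ⟨hsz, hmem⟩ := mkLogsSq_spec hS' n hA0
      have hold : ∀ (x : MI) (m : ℕ), 1 ≤ m → m ≤ n →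
          MI.mem S' (Real.log m) ((A0.push x).getD m default) := fun x m h1 h2 ↦ by
        rw [getD_push_of_lt' (by rw [hsz]; omega)]
        exact hmem m h1 h2
      have key : ∀ x : MI, MI.mem S' (Real.log (n + 1 : ℕ)) x → A = A0.push x →
          A.size = n + 1 + 1 ∧
            ∀ m : ℕ, 1 ≤ m → m ≤ n + 1 → MI.mem S' (Real.log m) (A.getD m default) := by
        rintro x hx rfl
        refine ⟨by simp [hsz], fun m h1 h2 ↦ ?_⟩
        rcases Nat.lt_succ_iff_lt_or_eq.1 (Nat.lt_succ_of_le h2) with hlt | heq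
        · exact hold x m h1 (Nat.lt_succ_iff.1 hlt)
        · subst heq
          have e2 : (A0.push x).getD (n + 1) default = x := by
            rw [← hsz]; exact getD_push_size'
          rw [e2]
          exact hx
      split_ifs at h with h0 h1 hp
      · -- `n = 0`: `log 1 = 0`
        subst h0
        simp only [Option.some.injEq] at h
        refine key _ ?_ h.symm
        simpa using MI.mem_ofInt S' 0
      · -- `n = 1`: `log 2`
        subst h1
        split at h
        · rename_i L hL
          simp only [Option.some.injEq] at h
          refine key _ ?_ h.symm
          simpa using MI.mem_logTwo hS' hL
        · simp at h
      · -- odd prime `m = n + 1 ≥ 3`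
        split at h
        · rename_i Y hY
          simp only [Option.some.injEq] at h
          refine key _ ?_ h.symm
          set m := n + 1 with hmdef
          have hm3 : 3 ≤ m := by omega
          have hmodd : m % 2 = 1 := by
            by_contra hev
            have h2d : 2 ∣ m := Nat.dvd_of_mod_eq_zero (by omega)
            have hle : m.minFac ≤ 2 := Nat.minFac_le_of_dvd (le_refl 2) h2d
            omega
          -- the three earlier entries
          have hA : MI.mem S' (Real.log (m - 1 : ℕ)) (A0.getD n default) := by
            have := hmem n (by omega) le_rfl
            rwa [show m - 1 = n by omega]
          have hB : MI.mem S' (Real.log 2) (A0.getD 2 default) := by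
            have := hmem 2 (by norm_num) (by omega)
            simpa using this
          have hC : MI.mem S' (Real.log ((m + 1) / 2 : ℕ)) (A0.getD ((n + 2) / 2) default) := by
            have e : (n + 2) / 2 = (m + 1) / 2 := by rw [hmdef]
            rw [e]
            exact hmem ((m + 1) / 2) (by omega) (by omega)
          have hY' := MI.mem_logOneSub hS' hY (MI.mem_ofFrac S' 1 (q := m * m) (by positivity))
          have hsum := MI.mem_divNat (MI.mem_sub (MI.mem_add (MI.mem_add hA hB) hC) hY') (n := 2) (by norm_num)
          convert hsum using 1
          rw [log_odd_eq hm3 hmodd]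
          push_cast
          ring
        · simp at h
      · -- composite
        simp only [Option.some.injEq] at h
        refine key _ ?_ h.symm
        set m := n + 1 with hm
        have hm1 : m ≠ 1 := by omega
        have hpr : m.minFac.Prime := Nat.minFac_prime hm1
        have h2p : 2 ≤ m.minFac := hpr.two_le
        have hle : m.minFac ≤ m := Nat.minFac_le (by omega)
        have hltm : m.minFac < m := lt_of_le_of_ne hle hp
        obtain ⟨q, hq⟩ := Nat.minFac_dvd m
        have hq1 : 1 ≤ q := by
          rcases Nat.eq_zero_or_pos q with h' | h'
          · rw [h', mul_zero] at hq; omega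
          · exact h'
        have hqdiv : m / m.minFac = q := Nat.div_eq_of_eq_mul_right (by omega) hq
        have hqn : q ≤ n := by
          have : 2 * q ≤ m := by
            calc 2 * q ≤ m.minFac * q := Nat.mul_le_mul_right _ h2p
              _ = m := hq.symm
          omega
        have hpn : m.minFac ≤ n := by omega
        have h1' := hmem m.minFac (by omega) hpn
        have h2' := hmem q hq1 hqn
        have hmr : ((m : ℕ) : ℝ) = (m.minFac : ℝ) * (q : ℝ) := by exact_mod_cast hq
        have e : Real.log (m : ℕ) = Real.log (m.minFac : ℕ) + Real.log (q : ℕ) := by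
          rw [hmr, Real.log_mul (by exact_mod_cast hpr.pos.ne') (by exact_mod_cast (show q ≠ 0 by omega))]
        rw [hqdiv, e]
        exact MI.mem_add h1' h2'

/-! ## The table builder -/

/-- Build tables as `mkTablesFast` does, with the `1/p²` log table at `bits = log₂ S + guard + 4`
series precision. [folklore] -/
def mkTablesFast2 (S N nu guard Kpi Kexp kexp KI kI : ℕ) : Option Tables :=
  let S' := S * 2 ^ guard
  let bits := Nat.log2 S + guard + 4
  if 0 < S ∧ 2 ≤ N ∧ nu ≠ 0 then
    match MI.pi S' Kpi, mkLogsSq S' bits N, emRatiosFast nu with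
    | some P, some A, some R =>
        some ⟨S, N, nu, MI.rescale S' S P, A.map (MI.rescale S' S), R, Kexp, kexp, KI, kI⟩
    | _, _, _ => none
  else none

/-- Tables built by `mkTablesFast2` are valid. [folklore] -/
theorem mkTablesFast2_valid {S N nu guard Kpi Kexp kexp KI kI : ℕ} {T : Tables}
    (h : mkTablesFast2 S N nu guard Kpi Kexp kexp KI kI = some T) : T.Valid := by
  unfold mkTablesFast2 at h
  simp only at h
  split_ifs at h with hc
  split at h
  · rename_i P A R hP hA hR
    simp only [Option.some.injEq] at h
    subst h
    obtain ⟨hS, hN, hnu⟩ := hc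
    have hS' : 0 < S * 2 ^ guard := Nat.mul_pos hS (pow_pos (by norm_num) _)
    obtain ⟨hsz, hmem⟩ := mkLogsSq_spec (bits := Nat.log2 S + guard + 4) hS' N hA
    refine ⟨hS, hN, hnu, MI.mem_rescale hS' S (MI.mem_pi _ hP), by simp [hsz], fun n h1 h2 ↦ ?_, ?_⟩
    · have h2' : n ≤ N := h2
      have hlt : n < A.size := by rw [hsz]; omega
      show MI.mem S (Real.log n) ((A.map (MI.rescale (S * 2 ^ guard) S)).getD n default)
      have e : (A.map (MI.rescale (S * 2 ^ guard) S)).getD n default =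
          MI.rescale (S * 2 ^ guard) S (A.getD n default) := by
        rw [Array.getD_eq_getD_getElem?, Array.getElem?_map, getElem?_pos A n hlt, Option.map_some,
          Option.getD_some, Array.getD_eq_getD_getElem?, getElem?_pos A n hlt, Option.getD_some]
      rw [e]
      exact MI.mem_rescale hS' S (hmem n h1 h2)
    · rw [← emRatiosFast_eq]; exact hR
  · simp at h

/-- `mkTablesFast2` records the scale it is given. [folklore] -/
theorem mkTablesFast2_S {S N nu guard Kpi Kexp kexp KI kI : ℕ} {T : Tables}
    (h : mkTablesFast2 S N nu guard Kpi Kexp kexp KI kI = some T) : T.S = S := by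
  unfold mkTablesFast2 at h
  simp only at h
  split_ifs at h
  split at h
  · simp only [Option.some.injEq] at h
    subst h; rfl
  · simp at h

/-- `mkTablesFast2` records the truncation point it is given. [folklore] -/
theorem mkTablesFast2_N {S N nu guard Kpi Kexp kexp KI kI : ℕ} {T : Tables}
    (h : mkTablesFast2 S N nu guard Kpi Kexp kexp KI kI = some T) : T.N = N := by
  unfold mkTablesFast2 at h
  simp only at h
  split_ifs at h
  split at h
  · simp only [Option.some.injEq] at h
    subst h; rfl
  · simp at h

end Literature.NumberTheory.LFunctions.ZetaNumerics
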